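import Mathlib
import Literature.NumberTheory.Sieve.SieveFrameworkFundamentalLemma
import Literature.NumberTheory.Sieve.ParityBarrierProofs
import Literature.NumberTheory.Sieve.RoughOmegaCellsClassesBV
import Summits.Parity.GeneralizedHardyLittlewood.Theorems.ParityLeakOneFifthPlainSplitCalibTools
import Summits.Parity.GeneralizedHardyLittlewood.Theorems.ParityLeakOneFifthPlainSplitTwistedPrimesLower
import Summits.Parity.BatemanHorn.Theorems.RoughParitySectorsOddSectorShareLinearSieveDecouplingOddAux2
import HarnessLib

/-!
# Route ParityLeakOneFifth, crux `PlainSplit` (stmt-Parity-18382), skeleton `calib-split`: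
# the sieve step for twisted `Ω`-cells

For the stubs `stub_twistedE3Upper` (`Ω = 3`, `Y = x^{1/5}`) and `stub_twistedBoundaryUpper`
(`Ω = 2`, `Y = x^{1/2−2ε}`) one must count the `z`-rough `n ∈ (x, 2x]` (`z = exp((log log x)²)`)
whose shift `b = n + 2` lies in an `Ω`-cell of the `Y`-rough integers,
`Φ_{i+1}(·, Y) = {b : P⁻(b) ≥ Y, Ω(b) = i+1}`.  This file proves the SIEVE STEP
(`twistedCell_sieve_le`): the count is at most
`(#Φ_{i+1}(2x+2, Y) − #Φ_{i+1}(x+2, Y))·V_sh(z)·(1 + C₁e^{−log L/log z}) + C₂Σ_{X=2x+2,x+2} X/(log X)^A`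
for `2 < z ≤ L`, `z ≤ Y ≤ x + 2`, `log(2x+2) ≤ n log Y`, `L ≤ (x+2)^{1/4}`: the uniform fundamental
lemma (`SieveSequence.fundamental_lemma_uniform_holds`) for the sequence `1[n ∈ (x,2x], n+2 ∈ Φ]`
with the shifted-primes density `1/φ(d)` (odd `d`; `hasSieveDimension_shiftedPrimes_two_one_holds`,
density product `V_sh`: `densityProduct_shiftedPrimes_two`), whose remainders are differences of the
class discrepancies of the cell at heights `2x+2`, `x+2` in the class `2 (mod d)`, bounded on average
over `d ≤ X^{1/4}` by the tree's Bombieri–Vinogradov theorem for the `Ω`-cells of the rough integers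
`RoughCellsAP.exists_sum_abs_cellClassDisc_le` (Motohashi / BFI Theorem 0, proved in the tree).
-/

namespace Summit.Parity.GeneralizedHardyLittlewood.Theorems.ParityLeakOneFifth

open Finset Real
open scoped ArithmeticFunction.Omega
open Literature.NumberTheory.Sieve

/-! ### Small dictionary lemmas -/

/-- For `b ≥ 2`: all prime factors of `b` are `≥ N` iff `N ≤ minFac b`. -/
theorem forall_primeFactors_le_iff {b N : ℕ} (hb : 2 ≤ b) :
    (∀ p ∈ b.primeFactors, N ≤ p) ↔ N ≤ b.minFac := by
  constructor
  · intro h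
    exact h _ (Nat.mem_primeFactors.2 ⟨Nat.minFac_prime (by omega), Nat.minFac_dvd b, by omega⟩)
  · intro h p hp
    obtain ⟨hpr, hdvd, -⟩ := Nat.mem_primeFactors.1 hp
    exact h.trans (Nat.minFac_le_of_dvd hpr.two_le hdvd)

/-- An element of `roughIcc N t` with `N ≥ 3` is odd. -/
theorem odd_of_mem_roughIcc {N t b : ℕ} (hb : b ∈ roughIcc N t) (hN : 3 ≤ N) : ¬ 2 ∣ b := by
  intro h2
  rw [mem_roughIcc] at hb
  have := hb.2 2 Nat.prime_two h2
  omega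

/-- A window of a cell: `#{b ∈ Φ(M) : P b} − #{b ∈ Φ(M') : P b} = #{b ∈ Φ(M) : P b ∧ M' < b}` for
`M' ≤ M` (`roughIcc N M' = roughIcc N M ∩ [1, M']`). -/
theorem card_cell_window (N M M' : ℕ) (hM : M' ≤ M) (Q P : ℕ → Prop) [DecidablePred Q]
    [DecidablePred P] :
    ((#(((roughIcc N M).filter Q).filter P) : ℝ) - #(((roughIcc N M').filter Q).filter P)) =
      #(((roughIcc N M).filter Q).filter (fun b => P b ∧ M' < b)) := by
  have hsplit := Finset.card_filter_add_card_filter_not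
    (s := ((roughIcc N M).filter Q).filter P) (fun b : ℕ => M' < b)
  have h1 : (((roughIcc N M).filter Q).filter P).filter (fun b : ℕ => M' < b) =
      ((roughIcc N M).filter Q).filter (fun b => P b ∧ M' < b) := by
    rw [Finset.filter_filter]
  have h2 : (((roughIcc N M).filter Q).filter P).filter (fun b : ℕ => ¬ M' < b) =
      ((roughIcc N M').filter Q).filter P := by
    ext b
    simp only [Finset.mem_filter, mem_roughIcc, not_lt]
    constructor
    · rintro ⟨⟨⟨⟨⟨h1, -⟩, hr⟩, hQ⟩, hP⟩, hle⟩
      exact ⟨⟨⟨⟨h1, hle⟩, hr⟩, hQ⟩, hP⟩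
    · rintro ⟨⟨⟨⟨h1, hle⟩, hr⟩, hQ⟩, hP⟩
      exact ⟨⟨⟨⟨⟨h1, hle.trans hM⟩, hr⟩, hQ⟩, hP⟩, hle⟩
  rw [h1, h2] at hsplit
  have := congrArg (fun k : ℕ => (k : ℝ)) hsplit
  push_cast at this
  linarith

/-! ### The sifted sequence `1[m ∈ (x, 2x], m + 2 ∈ Φ_{i+1}(2x+2, ⌈Y⌉)]`, described by hypotheses -/

/-- The sifted sum of the cell sequence is the twisted count. -/
theorem cellSeq_sifted_eq (x i N : ℕ) (z : ℝ) (A : SieveSequence)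
    (hA : ∀ m : ℕ, A.a m = if m ∈ Finset.Ioc x (2 * x) ∧ m + 2 ∈
      (roughIcc N (2 * x + 2)).filter (fun b : ℕ => ArithmeticFunction.cardFactors b = i + 1)
      then 1 else 0) :
    A.sifted (2 * (x : ℝ)) (primesProdBelow z) =
      #((Finset.Ioc x (2 * x)).filter (fun m : ℕ => (∀ p ∈ m.primeFactors, z ≤ (p : ℝ)) ∧
          N ≤ (m + 2).minFac ∧ ArithmeticFunction.cardFactors (m + 2) = i + 1)) := by
  rw [SieveSequence.sifted, show ((2 * (x : ℝ))) = ((2 * x : ℕ) : ℝ) by push_cast; ring,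
    Nat.floor_natCast]
  simp only [hA]
  rw [Finset.sum_ite, Finset.sum_const_zero, add_zero, Finset.sum_const, nsmul_eq_mul, mul_one]
  congr 1
  apply congrArg
  ext m
  simp only [Finset.mem_filter, Finset.mem_Ioc, mem_roughIcc]
  constructor
  · rintro ⟨⟨⟨-, -⟩, hcop⟩, ⟨hx1, hx2⟩, ⟨⟨-, hr⟩, hΩ⟩⟩
    have hm0 : m ≠ 0 := by omega
    refine ⟨⟨hx1, hx2⟩, (rough_iff_coprime hm0 z).2 hcop, ?_, hΩ⟩
    exact (forall_primeFactors_le_iff (by omega)).1 fun p hp =>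
      hr p (Nat.prime_of_mem_primeFactors hp) (Nat.dvd_of_mem_primeFactors hp)
  · rintro ⟨⟨hx1, hx2⟩, hrough, hmin, hΩ⟩
    have hm0 : m ≠ 0 := by omega
    refine ⟨⟨⟨by omega, hx2⟩, (rough_iff_coprime hm0 z).1 hrough⟩, ⟨hx1, hx2⟩,
      ⟨⟨by omega, by omega⟩, ?_⟩, hΩ⟩
    intro p hp hpd
    exact ((forall_primeFactors_le_iff (by omega)).2 hmin) p
      (Nat.mem_primeFactors.2 ⟨hp, hpd, by omega⟩)

/-- The congruence sums of the cell sequence: `A_d(2x) = #{b ∈ Φ(2x+2) : b ≡ 2 (d), x + 2 < b}`. -/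
theorem cellSeq_congrSum_eq (x i N : ℕ) (A : SieveSequence)
    (hA : ∀ m : ℕ, A.a m = if m ∈ Finset.Ioc x (2 * x) ∧ m + 2 ∈
      (roughIcc N (2 * x + 2)).filter (fun b : ℕ => ArithmeticFunction.cardFactors b = i + 1)
      then 1 else 0) (d : ℕ) :
    A.congrSum d (2 * (x : ℝ)) =
      #(((roughIcc N (2 * x + 2)).filter (fun b : ℕ => ArithmeticFunction.cardFactors b = i + 1)).filter
        (fun b : ℕ => Nat.ModEq d b 2 ∧ x + 2 < b)) := by
  rw [SieveSequence.congrSum, show ((2 * (x : ℝ))) = ((2 * x : ℕ) : ℝ) by push_cast; ring,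
    Nat.floor_natCast]
  simp only [hA]
  rw [Finset.sum_ite, Finset.sum_const_zero, add_zero, Finset.sum_const, nsmul_eq_mul, mul_one]
  congr 1
  refine Finset.card_bij (fun m _ => m + 2) ?_ ?_ ?_
  · intro m hm
    simp only [Finset.mem_filter, Finset.mem_Ioc] at hm ⊢
    obtain ⟨⟨⟨-, -⟩, hdm⟩, ⟨hx1, hx2⟩, hcell⟩ := hm
    refine ⟨hcell, ?_, by omega⟩
    exact ((Nat.modEq_iff_dvd' (by omega : 2 ≤ m + 2)).2 (by simpa using hdm)).symm
  · intro m₁ hm₁ m₂ hm₂ h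
    simpa using h
  · intro b hb
    simp only [Finset.mem_filter] at hb
    obtain ⟨hcell, hmod, hxb⟩ := hb
    have hb2 : b ≤ 2 * x + 2 := (mem_roughIcc.1 hcell.1).1.2
    refine ⟨b - 2, ?_, by omega⟩
    simp only [Finset.mem_filter, Finset.mem_Ioc]
    have hdvd : d ∣ b - 2 := (Nat.modEq_iff_dvd' (by omega : 2 ≤ b)).1 hmod.symm
    refine ⟨⟨⟨by omega, by omega⟩, hdvd⟩, ⟨by omega, by omega⟩, ?_⟩
    rw [show b - 2 + 2 = b by omega]; exact hcell

/-- The congruence sum of the cell sequence vanishes at even moduli when the cell is odd (`N ≥ 3`). -/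
theorem cellSeq_congrSum_even (x i N : ℕ) (hN : 3 ≤ N) (A : SieveSequence)
    (hA : ∀ m : ℕ, A.a m = if m ∈ Finset.Ioc x (2 * x) ∧ m + 2 ∈
      (roughIcc N (2 * x + 2)).filter (fun b : ℕ => ArithmeticFunction.cardFactors b = i + 1)
      then 1 else 0) {d : ℕ} (h2 : 2 ∣ d) :
    A.congrSum d (2 * (x : ℝ)) = 0 := by
  rw [cellSeq_congrSum_eq x i N A hA d]
  norm_cast
  rw [Finset.card_eq_zero, Finset.filter_eq_empty_iff]
  rintro b hb ⟨hmod, -⟩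
  have hodd := odd_of_mem_roughIcc (Finset.mem_filter.1 hb).1 hN
  have hΩ := (Finset.mem_filter.1 hb).2
  have hb2 : 2 ≤ b := by
    by_contra h
    rw [not_le] at h
    interval_cases b <;> simp [ArithmeticFunction.cardFactors_one] at hΩ
  have hdvd : d ∣ b - 2 := (Nat.modEq_iff_dvd' hb2).1 hmod.symm
  have : 2 ∣ b := by
    have h := h2.trans hdvd
    have : 2 ∣ (b - 2) + 2 := Nat.dvd_add h (dvd_refl 2)
    rwa [Nat.sub_add_cancel hb2] at this
  exact hodd this

/-- The remainder of the cell sequence (density `1/φ` on odd moduli, size the cell's window count)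
at an odd modulus `d` whose prime factors are `< N` is the difference of the class discrepancies
of the cell at heights `2x+2` and `x+2` in the class `2 (mod d)`. -/
theorem cellSeq_remainder_odd (x i N : ℕ) (A : SieveSequence)
    (hA : ∀ m : ℕ, A.a m = if m ∈ Finset.Ioc x (2 * x) ∧ m + 2 ∈
      (roughIcc N (2 * x + 2)).filter (fun b : ℕ => ArithmeticFunction.cardFactors b = i + 1)
      then 1 else 0)
    (hdens : A.density = shiftedPrimesDensity 2)
    (hsize : A.size (2 * (x : ℝ)) =
      (#((roughIcc N (2 * x + 2)).filter (fun b : ℕ => ArithmeticFunction.cardFactors b = i + 1)) : ℝ) -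
      #((roughIcc N (x + 2)).filter (fun b : ℕ => ArithmeticFunction.cardFactors b = i + 1)))
    {d : ℕ} (hd : 0 < d) (h2 : ¬ 2 ∣ d) (hdN : ∀ p : ℕ, p.Prime → p ∣ d → p < N) :
    A.remainder d (2 * (x : ℝ)) =
      ((((#((roughIcc N (2 * x + 2)).filter (fun b : ℕ => ArithmeticFunction.cardFactors b = i + 1 ∧ Nat.ModEq d b 2))) : ℕ) : ℝ) - (((#((roughIcc N (2 * x + 2)).filter (fun b : ℕ => ArithmeticFunction.cardFactors b = i + 1 ∧ b.Coprime d))) : ℕ) : ℝ) / ((Nat.totient d : ℕ) : ℝ)) -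
      ((((#((roughIcc N (x + 2)).filter (fun b : ℕ => ArithmeticFunction.cardFactors b = i + 1 ∧ Nat.ModEq d b 2))) : ℕ) : ℝ) - (((#((roughIcc N (x + 2)).filter (fun b : ℕ => ArithmeticFunction.cardFactors b = i + 1 ∧ b.Coprime d))) : ℕ) : ℝ) / ((Nat.totient d : ℕ) : ℝ)) := by
  have hcop2 : d.Coprime 2 := (Nat.prime_two.coprime_iff_not_dvd.2 h2).symm
  have hdensd : A.density d = ((Nat.totient d : ℕ) : ℝ)⁻¹ := by
    rw [hdens, shiftedPrimesDensity_apply, if_pos ⟨hcop2, hd.ne'⟩]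
  rw [SieveSequence.remainder, cellSeq_congrSum_eq x i N A hA d, hdensd, hsize]
  have hwin := card_cell_window N (2 * x + 2) (x + 2) (by omega)
    (fun b : ℕ => ArithmeticFunction.cardFactors b = i + 1) (fun b : ℕ => Nat.ModEq d b 2)
  have hcopM : ∀ M : ℕ, (roughIcc N M).filter (fun b : ℕ =>
      ArithmeticFunction.cardFactors b = i + 1 ∧ b.Coprime d) =
      (roughIcc N M).filter (fun b : ℕ => ArithmeticFunction.cardFactors b = i + 1) := by
    intro M
    ext b
    simp only [Finset.mem_filter]
    constructor
    · rintro ⟨hr, hΩ, -⟩; exact ⟨hr, hΩ⟩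
    · rintro ⟨hr, hΩ⟩
      exact ⟨hr, hΩ, Summit.Parity.BatemanHorn.Cruxes.OddSectorShareLinear.Birth.SieveDecouplingOdd.coprime_of_mem_roughIcc
        hr hdN⟩
  have hff : ∀ M : ℕ, (roughIcc N M).filter (fun b : ℕ =>
      ArithmeticFunction.cardFactors b = i + 1 ∧ Nat.ModEq d b 2) =
      ((roughIcc N M).filter (fun b : ℕ => ArithmeticFunction.cardFactors b = i + 1)).filter
        (fun b : ℕ => Nat.ModEq d b 2) := by
    intro M; rw [Finset.filter_filter]
  rw [hcopM, hcopM, hff, hff, ← hwin]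
  ring

/-! ### The sieve step -/

/-- **Sieve step for twisted `Ω`-cells.** For every `i, n` and real `A` there are `C₁ > 0`, `C₂ ≥ 0`
such that for all `x : ℕ` and reals `z, L, Y` with `2 < z ≤ L`, `z ≤ Y ≤ x + 2`,
`log(2x+2) ≤ n·log Y` and `L ≤ (x+2)^{1/4}`: the number of `m ∈ (x, 2x]` with `m` `z`-rough,
`P⁻(m+2) ≥ ⌈Y⌉` and `Ω(m+2) = i+1` is at most
`(#Φ_{i+1}(2x+2, Y) − #Φ_{i+1}(x+2, Y))·V_sh(z)·(1 + C₁e^{−log L/log z}) + C₂Σ_{X=2x+2,x+2} X/(log X)^A`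
(`Φ_{i+1}(X, Y) = {b ∈ roughIcc ⌈Y⌉ X : Ω b = i+1}`).  Fundamental lemma for the sequence
`1[m ∈ (x,2x], m+2 ∈ Φ]` with density `1/φ` on odd moduli; remainders by
`RoughCellsAP.exists_sum_abs_cellClassDisc_le`. -/
theorem twistedCell_sieve_le (i n : ℕ) (A : ℝ) :
    ∃ C₁ C₂ : ℝ, 0 < C₁ ∧ 0 ≤ C₂ ∧ ∀ (x : ℕ) (z L Y : ℝ), 2 < z → z ≤ L → z ≤ Y →
      Y ≤ (x : ℝ) + 2 → Real.log (2 * (x : ℝ) + 2) ≤ n * Real.log Y →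
      L ≤ ((x : ℝ) + 2) ^ ((1 : ℝ) / 4) →
      (#((Finset.Ioc x (2 * x)).filter (fun m : ℕ => (∀ p ∈ m.primeFactors, z ≤ (p : ℝ)) ∧
          ⌈Y⌉₊ ≤ (m + 2).minFac ∧ ArithmeticFunction.cardFactors (m + 2) = i + 1)) : ℝ) ≤
        ((#((roughIcc ⌈Y⌉₊ (2 * x + 2)).filter
            (fun b => ArithmeticFunction.cardFactors b = i + 1)) : ℝ) -
          #((roughIcc ⌈Y⌉₊ (x + 2)).filter (fun b => ArithmeticFunction.cardFactors b = i + 1))) *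
          (∏ p ∈ (Finset.range ⌈z⌉₊).filter (fun p : ℕ => p.Prime ∧ p ≠ 2), (1 - 1 / ((p : ℝ) - 1))) *
          (1 + C₁ * Real.exp (-(Real.log L / Real.log z))) +
        (C₂ * (2 * (x : ℝ) + 2) / Real.log (2 * (x : ℝ) + 2) ^ A +
          C₂ * ((x : ℝ) + 2) / Real.log ((x : ℝ) + 2) ^ A) := by
  obtain ⟨K, hdim⟩ := hasSieveDimension_shiftedPrimes_two_one_holds
  obtain ⟨C₁, hC₁, hFL⟩ := SieveSequence.fundamental_lemma_uniform_holds 1 K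
  obtain ⟨C₂, hC₂, hBV⟩ := RoughCellsAP.exists_sum_abs_cellClassDisc_le n A
  refine ⟨C₁, C₂, hC₁, hC₂, ?_⟩
  intro x z L Y hz2 hzL hzY hYx hlogn hL4
  set N : ℕ := ⌈Y⌉₊ with hN
  have hN3 : 3 ≤ N := by
    rw [hN]; exact Nat.lt_ceil.2 (by push_cast; linarith)
  have hY2 : 2 ≤ Y := by linarith
  have hx0 : (0 : ℝ) ≤ x := Nat.cast_nonneg x
  have hYX2 : Y ≤ ((2 * x + 2 : ℕ) : ℝ) := by push_cast; linarith
  have hYX1 : Y ≤ ((x + 2 : ℕ) : ℝ) := by push_cast; linarith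
  have hlog1 : Real.log ((x + 2 : ℕ) : ℝ) ≤ n * Real.log Y := by
    refine le_trans (Real.log_le_log (by positivity) ?_) hlogn
    push_cast; linarith
  have hlog2 : Real.log ((2 * x + 2 : ℕ) : ℝ) ≤ n * Real.log Y := by push_cast; exact hlogn
  -- primes dividing `d ∣ P(z)` are `< N`
  have hsmall : ∀ d : ℕ, d ∣ primesProdBelow z → ∀ p : ℕ, p.Prime → p ∣ d → p < N := by
    intro d hd p hp hpd
    have hpz : (p : ℝ) < z := (dvd_primesProdBelow_iff hp z).1 (hpd.trans hd)
    rw [hN]; exact Nat.lt_ceil.2 (hpz.trans_le hzY)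
  -- the level is below `X^{1/4}` at both heights
  have hsubset : ∀ M : ℕ, x + 2 ≤ M →
      (primesProdBelow z).divisors.filter (fun d : ℕ => (d : ℝ) ≤ L) ⊆
        Finset.Icc 1 ⌊((M : ℕ) : ℝ) ^ ((1 : ℝ) / 4)⌋₊ := by
    intro M hM d hd
    have hd' := Finset.mem_filter.1 hd
    have hM'' : (x : ℝ) + 2 ≤ (M : ℝ) := by
      have h := (Nat.cast_le (α := ℝ)).2 hM; push_cast at h; exact h
    have hM' : ((x : ℝ) + 2) ^ ((1 : ℝ) / 4) ≤ ((M : ℕ) : ℝ) ^ ((1 : ℝ) / 4) :=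
      Real.rpow_le_rpow (by positivity) hM'' (by norm_num)
    exact Finset.mem_Icc.2 ⟨Nat.pos_of_mem_divisors hd'.1,
      Nat.le_floor (hd'.2.trans (hL4.trans hM'))⟩
  -- the sequence
  set sz : ℝ := (#((roughIcc N (2 * x + 2)).filter
      (fun b : ℕ => ArithmeticFunction.cardFactors b = i + 1)) : ℝ) -
    #((roughIcc N (x + 2)).filter (fun b : ℕ => ArithmeticFunction.cardFactors b = i + 1)) with hsz
  have hsz0 : 0 ≤ sz := by
    rw [hsz, sub_nonneg]
    exact_mod_cast Finset.card_le_card (Finset.filter_subset_filter _ (roughIcc_mono N (by omega)))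
  let 𝒜 : SieveSequence :=
    { a := fun m => if m ∈ Finset.Ioc x (2 * x) ∧ m + 2 ∈ (roughIcc N (2 * x + 2)).filter
          (fun b : ℕ => ArithmeticFunction.cardFactors b = i + 1) then 1 else 0
      a_nonneg := fun m => by positivity
      size := fun _ => sz
      density := shiftedPrimesDensity 2
      density_mult := isMultiplicative_shiftedPrimesDensity 2 }
  have hA : ∀ m : ℕ, 𝒜.a m = if m ∈ Finset.Ioc x (2 * x) ∧ m + 2 ∈
      (roughIcc N (2 * x + 2)).filter (fun b : ℕ => ArithmeticFunction.cardFactors b = i + 1)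
      then 1 else 0 := fun m => rfl
  have hdimA : HasSieveDimension 𝒜.density 1 K := hdim
  have hdensA : 𝒜.densityProduct (primesProdBelow z) =
      ∏ p ∈ (Finset.range ⌈z⌉₊).filter (fun p : ℕ => p.Prime ∧ p ≠ 2), (1 - 1 / ((p : ℝ) - 1)) :=
    densityProduct_shiftedPrimes_two z
  -- residues for Bombieri–Vinogradov
  set c : ℕ → ℕ := fun q => if 2 ∣ q then 1 else 2 with hc
  have hcq : ∀ q : ℕ, 0 < q → (c q).Coprime q := by
    intro q hq
    simp only [hc]
    split_ifs with h
    · exact Nat.coprime_one_left q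
    · exact Nat.prime_two.coprime_iff_not_dvd.2 h
  set disc : ℕ → ℕ → ℝ := fun M d =>
    ((#((roughIcc N M).filter (fun b : ℕ => ArithmeticFunction.cardFactors b = i + 1 ∧
        Nat.ModEq d b (c d))) : ℕ) : ℝ) -
      ((#((roughIcc N M).filter (fun b : ℕ => ArithmeticFunction.cardFactors b = i + 1 ∧
        b.Coprime d)) : ℕ) : ℝ) / ((Nat.totient d : ℕ) : ℝ) with hdisc
  -- remainders termwise
  have hremd : ∀ d ∈ (primesProdBelow z).divisors.filter (fun d : ℕ => (d : ℝ) ≤ L),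
      |𝒜.remainder d (2 * (x : ℝ))| ≤ |disc (2 * x + 2) d| + |disc (x + 2) d| := by
    intro d hd
    have hdv := (Nat.mem_divisors.1 (Finset.mem_filter.1 hd).1).1
    have hd0 : 0 < d := Nat.pos_of_mem_divisors (Finset.mem_filter.1 hd).1
    by_cases h2 : 2 ∣ d
    · have hdens0 : 𝒜.density d = 0 := by
        show shiftedPrimesDensity 2 d = 0
        rw [shiftedPrimesDensity_apply, if_neg]
        rintro ⟨hc', -⟩
        have : ¬ 2 ∣ d := (Nat.prime_two.coprime_iff_not_dvd.1 hc'.symm)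
        exact this h2
      rw [SieveSequence.remainder, cellSeq_congrSum_even x i N hN3 𝒜 hA h2, hdens0]
      simp only [zero_mul, sub_zero, abs_zero]
      positivity
    · have hc2 : c d = 2 := by simp [hc, h2]
      rw [cellSeq_remainder_odd x i N 𝒜 hA rfl rfl hd0 h2 (hsmall d hdv)]
      simp only [hdisc, hc2]
      exact abs_sub _ _
  -- summing with Bombieri–Vinogradov for the cells
  have hBV2 := hBV ((2 * x + 2 : ℕ) : ℝ) Y hY2 hYX2 hlog2 i c hcq
  have hBV1 := hBV ((x + 2 : ℕ) : ℝ) Y hY2 hYX1 hlog1 i c hcq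
  rw [Nat.floor_natCast] at hBV2 hBV1
  have hrem : ∑ d ∈ (primesProdBelow z).divisors.filter (fun d : ℕ => (d : ℝ) ≤ L),
      |𝒜.remainder d (2 * (x : ℝ))| ≤
      C₂ * ((2 * x + 2 : ℕ) : ℝ) / Real.log ((2 * x + 2 : ℕ) : ℝ) ^ A +
        C₂ * ((x + 2 : ℕ) : ℝ) / Real.log ((x + 2 : ℕ) : ℝ) ^ A := by
    refine (Finset.sum_le_sum hremd).trans ?_
    rw [Finset.sum_add_distrib]
    have s2 := Finset.sum_le_sum_of_subset_of_nonneg (hsubset (2 * x + 2) (by omega))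
      (f := fun d => |disc (2 * x + 2) d|) (fun _ _ _ => abs_nonneg _)
    have s1 := Finset.sum_le_sum_of_subset_of_nonneg (hsubset (x + 2) le_rfl)
      (f := fun d => |disc (x + 2) d|) (fun _ _ _ => abs_nonneg _)
    have e2 : ∑ d ∈ Finset.Icc 1 ⌊((2 * x + 2 : ℕ) : ℝ) ^ ((1 : ℝ) / 4)⌋₊, |disc (2 * x + 2) d| ≤
        C₂ * ((2 * x + 2 : ℕ) : ℝ) / Real.log ((2 * x + 2 : ℕ) : ℝ) ^ A := by
      simpa only [hdisc] using hBV2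
    have e1 : ∑ d ∈ Finset.Icc 1 ⌊((x + 2 : ℕ) : ℝ) ^ ((1 : ℝ) / 4)⌋₊, |disc (x + 2) d| ≤
        C₂ * ((x + 2 : ℕ) : ℝ) / Real.log ((x + 2 : ℕ) : ℝ) ^ A := by
      simpa only [hdisc] using hBV1
    linarith
  -- the fundamental lemma
  have hmain := hFL 𝒜 hdimA (2 * (x : ℝ)) z L hz2.le hzL (show (0 : ℝ) ≤ sz from hsz0)
  rw [cellSeq_sifted_eq x i N z 𝒜 hA, hdensA] at hmain
  have hup := (abs_le.1 hmain).2
  have hsize : 𝒜.size (2 * (x : ℝ)) = sz := rfl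
  rw [hsize] at hup
  push_cast at hrem ⊢
  have e : sz * (∏ p ∈ (Finset.range ⌈z⌉₊).filter (fun p : ℕ => p.Prime ∧ p ≠ 2),
      (1 - 1 / ((p : ℝ) - 1))) * (1 + C₁ * Real.exp (-(Real.log L / Real.log z))) =
      sz * (∏ p ∈ (Finset.range ⌈z⌉₊).filter (fun p : ℕ => p.Prime ∧ p ≠ 2),
        (1 - 1 / ((p : ℝ) - 1))) +
      C₁ * sz * (∏ p ∈ (Finset.range ⌈z⌉₊).filter (fun p : ℕ => p.Prime ∧ p ≠ 2),
        (1 - 1 / ((p : ℝ) - 1))) * Real.exp (-(Real.log L / Real.log z)) := by ring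
  rw [e]
  linarith

end Summit.Parity.GeneralizedHardyLittlewood.Theorems.ParityLeakOneFifth
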